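import Mathlib
import Literature.Analysis.FluidPDE.TypeIAncientMild
import Literature.Analysis.FluidPDE.SelfSimilar
import Literature.Analysis.FluidPDE.HyperbolicDSSOrbit

/-!
# Sketch (crux-ideate round 2, ideator 4) — crux stmt-NavierStokesRegularity-1217 (`NoTypeIBlowup`)

First-lemma signatures for the crux idea `conjugate-entropy-production`:
the ETERNAL CONJUGATE DENSITY `w` of a rate-class profile (positive unit-mass eternal solution of the
backward adjoint of the similarity advection–diffusion operator `∂ₛ + V·∇ − Δ`, `V = U + ½y`,
`U = lerayOrbit u`; = the route AdaptedFrequency's flow-adapted backward kernel read in Leray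
variables, = Pineau–Vicol's kernel element made non-autonomous), its Gaussian comparability, the
ENTROPY-PRODUCTION inequality of the conjugate diffusion, and the reversibility dichotomy.
Everything is stated over existing declarations; nothing here is proved.
-/

open MeasureTheory Set Metric Real
open scoped Laplacian

set_option linter.dupNamespace false

namespace Summit.NavierStokesRegularity.NavierStokesRegularity.Cruxes.Target.Ideator4

local notation "E3" => EuclideanSpace ℝ (Fin 3)

open Literature.Analysis.FluidPDE

/-- The similarity drift `V(s,y) = U(s,y) + ½ y` of a physical field `u` (`U` = Leray orbit about (0,0)). -/
noncomputable def simDrift (u : ℝ → E3 → E3) (s : ℝ) (y : E3) : E3 :=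
  lerayOrbit u s y + (1/2 : ℝ) • y

/-- `w` is a CONJUGATE DENSITY of `u` on the whole line `s ∈ ℝ`: positive, unit mass, jointly smooth,
and dual to the similarity transport operator in integrated form — for every smooth compactly
supported test function `f`,  `d/ds ∫ f w(s,·) = -∫ (Δf - V·∇f) w(s,·)`  (i.e. `∂ₛw = -Δw - div(V w)`). -/
def IsConjugateDensity (u : ℝ → E3 → E3) (w : ℝ → E3 → ℝ) : Prop :=
  (∀ s y, 0 < w s y) ∧ (∀ s, ∫ y, w s y = 1) ∧ ContDiff ℝ (⊤ : ℕ∞) (Function.uncurry w) ∧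
  ∀ f : E3 → ℝ, ContDiff ℝ (⊤ : ℕ∞) f → HasCompactSupport f →
    ∀ s, HasDerivAt (fun σ => ∫ y, f y * w σ y)
      (-(∫ y, ((Δ f) y - inner ℝ (simDrift u s y) (gradient f y)) * w s y)) s

/-- T1 (existence, uniqueness, Gaussian comparability of the eternal conjugate density; the Leray-variable,
two-ended form of the PROVED item `AdaptedFrequency.AdaptedKernelExists`, stmt-2956). -/
def EternalConjugateDensity : Prop :=
  ∀ C : ℝ, 0 < C → ∃ a b A B : ℝ, 0 < a ∧ 0 < b ∧ 0 < A ∧ 0 < B ∧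
    ∀ u : ℝ → E3 → E3, IsTypeIAncientMild C u →
      (∃ w, IsConjugateDensity u w ∧
        ∀ s y, a * exp (-A * ‖y‖ ^ 2) ≤ w s y ∧ w s y ≤ b * exp (-B * ‖y‖ ^ 2)) ∧
      (∀ w₁ w₂, IsConjugateDensity u w₁ → IsConjugateDensity u w₂ → w₁ = w₂)

/-- T2 (ENTROPY-PRODUCTION INEQUALITY, Cesàro form): along every rate-class profile with Gaussian-comparable
conjugate density, the long-window means satisfy  `⟨∫ ⟪y, U⟫ w⟩ ≥ -2 ⟨∫ ‖U‖² w⟩`  (the conjugate-mean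
INFLOW moment is at most twice the conjugate kinetic energy) — from `σ_s := ∫‖∇log w + V‖² w ≥ 0` and the
exact identity `σ_s = ∫‖V‖²w − 3/2 + d/ds ∫ w log w`. [new] -/
def EntropyProductionInequality : Prop :=
  ∀ C : ℝ, 0 < C → ∀ u : ℝ → E3 → E3, IsTypeIAncientMild C u → ∀ w, IsConjugateDensity u w →
    (∃ a b A B : ℝ, 0 < a ∧ 0 < b ∧ 0 < A ∧ 0 < B ∧
        ∀ s y, a * exp (-A * ‖y‖ ^ 2) ≤ w s y ∧ w s y ≤ b * exp (-B * ‖y‖ ^ 2)) →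
    ∀ ε : ℝ, 0 < ε → ∃ S₀ : ℝ, 0 < S₀ ∧ ∀ s₁ s₂ : ℝ, s₁ + S₀ ≤ s₂ →
      -(2 : ℝ) * ((s₂ - s₁)⁻¹ * ∫ s in s₁..s₂, ∫ y, ‖lerayOrbit u s y‖ ^ 2 * w s y) - ε ≤
        (s₂ - s₁)⁻¹ * ∫ s in s₁..s₂, ∫ y, inner ℝ y (lerayOrbit u s y) * w s y

/-- T3 (REVERSIBILITY DICHOTOMY): the conjugate diffusion of a rate-class profile is reversible
(zero entropy production, `∇log w + V ≡ 0`) only for the trivial profile. [new; 3 lines: `U` would be a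
bounded divergence-free gradient] -/
def ReversibilityDichotomy : Prop :=
  ∀ C : ℝ, 0 < C → ∀ u : ℝ → E3 → E3, IsTypeIAncientMild C u → ∀ w, IsConjugateDensity u w →
    (∀ s y, gradient (fun z => Real.log (w s z)) y + simDrift u s y = 0) → ∀ t < 0, ∀ x, u t x = 0

end Summit.NavierStokesRegularity.NavierStokesRegularity.Cruxes.Target.Ideator4
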